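import Mathlib
import HarnessLib
import Summits.Ventures.LatticeQCDFlow.Exactness.NCMCGeneralSpaceMarkovErgodic

/-!
# Two-time averages along an ergodic stream: empirical transition frequencies and transition rates of a stationary Markov chain are consistent

HONEST FRAMING: exact (Metropolis-corrected) sampling algorithms for lattice gauge theory;
figures of merit are autocorrelation/cost numbers at stated couplings and volumes; no
continuum-physics claim.

Venture `LatticeQCDFlow` (cell pub-lqcd), topic `Exactness`; FANOUT row 13 (`eng-snf`, GEN-17).
NEW WORK of the cell, not a published result; no definition is introduced; nothing is cited as a
fact (Birkhoff's pointwise ergodic theorem is the tree-PROVED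
`Literature.Dynamics.Ergodic.birkhoff_ergodic_theorem_of_ergodic_holds`).  Companion of
`NCMCGeneralSpaceErgodicRun.lean` (GEN-16), which typed Birkhoff averages of ONE-record observables
`φ(ω 0)`; the engine also reports numbers that are averages of TWO-TIME observables `φ(ω i, ω (i+1))`
— how often the chain moved from one level to the other, i.e. the lane acceptance rates of the NCMC
mode (`NCMCGeneralSpaceOccupancyChainRates.lean`).  This file supplies the general statements.

## Content

* §1 (any probability law `P` on streams `ℕ → E`, ergodic for the shift):
  `birkhoffSum_shift_pair`, `birkhoffAverage_shift_pair` (Birkhoff averages of `φ(ω 0, ω 1)` ARE the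
  running two-time averages), **`tendsto_sum_pair_div_ae_of_ergodic`** —
  `(1/n) Σ_{i<n} φ(ω i, ω (i+1)) → E_P φ(ω 0, ω 1)` almost surely for `φ(ω 0, ω 1) ∈ L¹(P)`.
* §2 (a Markov kernel `κ` on `S` started in an invariant probability law `π`, row 8's
  `Kernel.trajMeasure` object; `P{x_0 ∈ B, x_1 ∈ C} = ∫_B κ(z, C) dπ` is GEN-16's
  `chain_measureReal_eval_zero_one`): `indicator_mul_indicator_eq`,
  **`tendsto_transitionFreq_ae_chain`** — IF the chain is ergodic, the empirical frequency of
  transitions `B → C`, `(1/n) #{i<n : x_i ∈ B, x_{i+1} ∈ C}`, converges to `∫_B κ(z, C) dπ` a.s.;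
  **`tendsto_transitionRate_ae_chain`** — and the empirical transition RATE
  `#{i<n : x_i ∈ B, x_{i+1} ∈ C} / #{i<n : x_i ∈ B}` converges to `∫_B κ(z, C) dπ / π(B)` a.s.
  (`π(B) ≠ 0`).

NOT CLAIMED: rates of convergence; anything for non-stationary starts.
-/

namespace Summit.Ventures.LatticeQCDFlow.Exactness.GeneralNCMC

open MeasureTheory ProbabilityTheory Set Filter Finset
open scoped ENNReal Topology

/-! ## §1 Two-time Birkhoff averages along an ergodic stream -/

section Pair

variable {E : Type*} [MeasurableSpace E]

omit [MeasurableSpace E] in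
/-- The Birkhoff sums of a two-time observable along the shift are the running two-time sums. -/
theorem birkhoffSum_shift_pair (φ : E → E → ℝ) (n : ℕ) (ω : ℕ → E) :
    birkhoffSum (fun (ω : ℕ → E) (k : ℕ) => ω (k + 1)) (fun ω => φ (ω 0) (ω 1)) n ω =
      ∑ i ∈ range n, φ (ω i) (ω (i + 1)) := by
  unfold birkhoffSum
  refine sum_congr rfl fun i _ => ?_
  dsimp only
  rw [shift_iterate_apply, shift_iterate_apply, Nat.zero_add, Nat.add_comm 1 i]

omit [MeasurableSpace E] in
/-- The Birkhoff averages of a two-time observable along the shift are the running two-time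
averages. -/
theorem birkhoffAverage_shift_pair (φ : E → E → ℝ) (n : ℕ) (ω : ℕ → E) :
    birkhoffAverage ℝ (fun (ω : ℕ → E) (k : ℕ) => ω (k + 1)) (fun ω => φ (ω 0) (ω 1)) n ω =
      (∑ i ∈ range n, φ (ω i) (ω (i + 1))) / n := by
  rw [birkhoffAverage.eq_1, birkhoffSum_shift_pair, smul_eq_mul, div_eq_inv_mul]

variable {P : Measure (ℕ → E)} [IsProbabilityMeasure P]

/-- **Two-time strong law along an ergodic stream** (Birkhoff): for `φ(ω 0, ω 1) ∈ L¹(P)`,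
`(1/n) Σ_{i<n} φ(ω i, ω (i+1)) → E_P φ(ω 0, ω 1)` for `P`-almost every stream. -/
theorem tendsto_sum_pair_div_ae_of_ergodic (hP : Ergodic (fun (ω : ℕ → E) (k : ℕ) => ω (k + 1)) P)
    {φ : E → E → ℝ} (hφ : Integrable (fun ω : ℕ → E => φ (ω 0) (ω 1)) P) :
    ∀ᵐ ω ∂P, Tendsto (fun n : ℕ => (∑ i ∈ range n, φ (ω i) (ω (i + 1))) / n) atTop
      (𝓝 (∫ ω, φ (ω 0) (ω 1) ∂P)) := by
  have hB := Literature.Dynamics.Ergodic.birkhoff_ergodic_theorem_of_ergodic_holds P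
    (fun (ω : ℕ → E) (k : ℕ) => ω (k + 1)) hP (fun ω => φ (ω 0) (ω 1)) hφ
  filter_upwards [hB] with ω hω
  exact hω.congr fun n => birkhoffAverage_shift_pair φ n ω

end Pair

/-! ## §2 Empirical transition frequencies and rates of a stationary Markov chain -/

section Chain

variable {S : Type*} [MeasurableSpace S] (κ : Kernel S S) [IsMarkovKernel κ]
variable {π : Measure S} [IsProbabilityMeasure π]

omit [MeasurableSpace S] in
/-- The product of the two indicators is the indicator of the two-time event. -/
theorem indicator_mul_indicator_eq (B C : Set S) (x : ℕ → S) :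
    B.indicator (1 : S → ℝ) (x 0) * C.indicator (1 : S → ℝ) (x 1) =
      ({x : ℕ → S | x 0 ∈ B} ∩ {x | x 1 ∈ C}).indicator 1 x := by
  by_cases hx0 : x 0 ∈ B
  · by_cases hx1 : x 1 ∈ C
    · rw [Set.indicator_of_mem hx0, Set.indicator_of_mem hx1,
        Set.indicator_of_mem (show x ∈ ({x : ℕ → S | x 0 ∈ B} ∩ {x | x 1 ∈ C}) from ⟨hx0, hx1⟩)]
      simp
    · rw [Set.indicator_of_notMem hx1, Set.indicator_of_notMem (show x ∉ _ from fun h => hx1 h.2)]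
      simp
  · rw [Set.indicator_of_notMem hx0, Set.indicator_of_notMem (show x ∉ _ from fun h => hx0 h.1)]
    simp

/-- **EMPIRICAL TRANSITION FREQUENCIES ARE CONSISTENT.**  Along an ergodic stationary Markov chain,
for measurable `B`, `C`: `(1/n) #{i<n : x_i ∈ B, x_{i+1} ∈ C} → ∫_B κ(z, C) dπ` almost surely. -/
theorem tendsto_transitionFreq_ae_chain
    (hErg : Ergodic (fun (x : ℕ → S) (k : ℕ) => x (k + 1))
      (Kernel.trajMeasure (X := fun _ : ℕ => S) π
        (fun n : ℕ => κ.comap (fun h : (j : ↥(Finset.Iic n)) → S => h ⟨n, Finset.mem_Iic.2 le_rfl⟩)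
          (measurable_pi_apply _))))
    (hπ : Kernel.Invariant κ π) {B C : Set S} (hB : MeasurableSet B) (hC : MeasurableSet C) :
    ∀ᵐ x ∂(Kernel.trajMeasure (X := fun _ : ℕ => S) π
        (fun n : ℕ => κ.comap (fun h : (j : ↥(Finset.Iic n)) → S => h ⟨n, Finset.mem_Iic.2 le_rfl⟩)
          (measurable_pi_apply _))),
      Tendsto (fun n : ℕ =>
          (∑ i ∈ range n, B.indicator (1 : S → ℝ) (x i) * C.indicator (1 : S → ℝ) (x (i + 1))) / n)
        atTop (𝓝 (∫ z in B, (κ z).real C ∂π)) := by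
  set P := Kernel.trajMeasure (X := fun _ : ℕ => S) π
    (fun n : ℕ => κ.comap (fun h : (j : ↥(Finset.Iic n)) → S => h ⟨n, Finset.mem_Iic.2 le_rfl⟩)
      (measurable_pi_apply _)) with hP
  have hBC : MeasurableSet ({x : ℕ → S | x 0 ∈ B} ∩ {x | x 1 ∈ C}) :=
    (measurable_pi_apply 0 hB).inter (measurable_pi_apply 1 hC)
  have hfun : (fun x : ℕ → S => B.indicator (1 : S → ℝ) (x 0) * C.indicator (1 : S → ℝ) (x 1)) =
      ({x : ℕ → S | x 0 ∈ B} ∩ {x | x 1 ∈ C}).indicator 1 :=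
    funext (indicator_mul_indicator_eq B C)
  have hint : Integrable (fun x : ℕ → S => B.indicator (1 : S → ℝ) (x 0) * C.indicator (1 : S → ℝ)
      (x 1)) P := by
    rw [hfun]
    exact (integrable_const (1 : ℝ)).indicator hBC
  have h := tendsto_sum_pair_div_ae_of_ergodic hErg
    (φ := fun a b => B.indicator (1 : S → ℝ) a * C.indicator (1 : S → ℝ) b) hint
  have hval : ∫ x, B.indicator (1 : S → ℝ) (x 0) * C.indicator (1 : S → ℝ) (x 1) ∂P =
      ∫ z in B, (κ z).real C ∂π := by
    rw [hfun, integral_indicator_one hBC, hP, chain_measureReal_eval_zero_one κ hπ hB hC]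
  rw [hval] at h
  exact h

/-- **EMPIRICAL TRANSITION RATES ARE CONSISTENT.**  Along an ergodic stationary Markov chain, for
measurable `B`, `C` with `π(B) ≠ 0`: the empirical rate of transitions from `B` into `C`,
`#{i<n : x_i ∈ B, x_{i+1} ∈ C} / #{i<n : x_i ∈ B}`, converges to `∫_B κ(z, C) dπ / π(B)` a.s. -/
theorem tendsto_transitionRate_ae_chain
    (hErg : Ergodic (fun (x : ℕ → S) (k : ℕ) => x (k + 1))
      (Kernel.trajMeasure (X := fun _ : ℕ => S) π
        (fun n : ℕ => κ.comap (fun h : (j : ↥(Finset.Iic n)) → S => h ⟨n, Finset.mem_Iic.2 le_rfl⟩)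
          (measurable_pi_apply _))))
    (hπ : Kernel.Invariant κ π) {B C : Set S} (hB : MeasurableSet B) (hC : MeasurableSet C)
    (hB0 : π B ≠ 0) :
    ∀ᵐ x ∂(Kernel.trajMeasure (X := fun _ : ℕ => S) π
        (fun n : ℕ => κ.comap (fun h : (j : ↥(Finset.Iic n)) → S => h ⟨n, Finset.mem_Iic.2 le_rfl⟩)
          (measurable_pi_apply _))),
      Tendsto (fun n : ℕ =>
          (∑ i ∈ range n, B.indicator (1 : S → ℝ) (x i) * C.indicator (1 : S → ℝ) (x (i + 1))) /
            ∑ i ∈ range n, B.indicator (1 : S → ℝ) (x i))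
        atTop (𝓝 ((∫ z in B, (κ z).real C ∂π) / π.real B)) := by
  have hBr : π.real B ≠ 0 := by
    rw [measureReal_def, ENNReal.toReal_ne_zero]
    exact ⟨hB0, measure_ne_top π B⟩
  have h1 := tendsto_transitionFreq_ae_chain κ hErg hπ hB hC
  have h2 := tendsto_sum_div_ae_chain κ hErg hπ
    (show Integrable (B.indicator (1 : S → ℝ)) π from (integrable_const (1 : ℝ)).indicator hB)
  rw [integral_indicator_one hB] at h2
  filter_upwards [h1, h2] with x hx1 hx2
  refine ((hx1.div hx2 hBr).congr' ?_)
  filter_upwards [eventually_gt_atTop 0] with n hn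
  have hn' : (n : ℝ) ≠ 0 := by exact_mod_cast hn.ne'
  rw [Pi.div_apply, div_div_div_cancel_right₀ hn']

end Chain

end Summit.Ventures.LatticeQCDFlow.Exactness.GeneralNCMC
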